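import Literature.Analysis.Complex.AffineHypersurfaceAlgebraization
import HarnessLib

/-!
# Serre's algebraisation lemma on a smooth affine hypersurface — usable form

Layer `Literature/Analysis/Complex`, sequel of `AffineHypersurfaceAlgebraization`: the same theorem
(`exists_mvPolynomial_eq_on_hypersurface'`) with the coefficient hypothesis in the satisfiable form
`deg a_j ≤ d - j` for all `j` (equivalently: the total degree of the defining polynomial `h(t, w)` is `≤ d`), using the
corrected bricks `exists_norm_root_le'` and `exists_powerSums'`. Statement: for `P = Σ_j a_j(w) X^j` over `ℂ[w₁,…,w_m]`
with `P.coeff d = c ≠ 0` constant, `deg a_j ≤ d - j`, and a separable fibre of the top-degree family, every function on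
`U = {P_w(t) = 0}` which is locally the restriction of holomorphic functions of `ℂ^m × ℂ` and has polynomial growth of
exponent `k` is the restriction of a polynomial of total degree `≤ k` (Serre, GAGA n° 19 Lemme 8, n° 20).

Everything is proved; no definitions, no named facts.

## References

* J.-P. Serre, *Géométrie algébrique et géométrie analytique*, Ann. Inst. Fourier 6 (1956), n° 19 Lemme 8, n° 20. [SerreGAGA1956]
-/

noncomputable section

open Polynomial Complex Metric Set Filter Finset Lagrange
open scoped Topology

namespace Literature.Analysis.Complex

namespace AffineHypersurface

open SCV Literature.RingTheory.MvPolynomial.NewtonPowerSums EntireQuotient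

variable {m d : ℕ} {c : ℂ} (P : Polynomial (MvPolynomial (Fin m) ℂ))

/-- **Serre's algebraisation lemma on a smooth affine hypersurface in Noether normal form** (usable form: coefficient
hypothesis `deg a_j ≤ d - j`, which holds for the family of a polynomial of total degree `≤ d`; the version in
`AffineHypersurfaceAlgebraization` asks `deg a_j + j ≤ d` for all `j`, which cannot be met). For the family
`P = Σ a_j(w) X^j` (`P.coeff d = c ≠ 0` constant, `deg a_j ≤ d - j`, some fibre of the top-degree family with
distinct roots) and a function `g` on `U = {P_w(t) = 0}` locally the restriction of holomorphic functions of
`ℂ^m × ℂ`, of growth `|g| ≤ C (1 + |(w,t)|)^k` on `U`, there is a polynomial `q ∈ ℂ[t, w]` of total degree `≤ k` with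
`q = g` on `U`. [cite: SerreGAGA1956, n° 19 Lemme 8 and n° 20] -/
theorem exists_mvPolynomial_eq_on_hypersurface' (hc : c ≠ 0) (hPd : P.natDegree ≤ d)
    (hPlead : P.coeff d = MvPolynomial.C c) (hPcoef : ∀ j, (P.coeff j).totalDegree ≤ d - j)
    (hsep : ∃ w₀ : Fin m → ℂ, ((∑ j ∈ range (d + 1), Polynomial.monomial j
      (MvPolynomial.homogeneousComponent (d - j) (P.coeff j))).map (MvPolynomial.eval w₀)).roots.Nodup)
    {g : (Fin m → ℂ) × ℂ → ℂ}
    (hhol : ∀ x : (Fin m → ℂ) × ℂ, (P.map (MvPolynomial.eval x.1)).eval x.2 = 0 →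
      ∃ W : Set ((Fin m → ℂ) × ℂ), IsOpen W ∧ x ∈ W ∧ ∃ G : (Fin m → ℂ) × ℂ → ℂ, DifferentiableOn ℂ G W ∧
        ∀ y ∈ W, (P.map (MvPolynomial.eval y.1)).eval y.2 = 0 → G y = g y)
    {C : ℝ} (hC : 0 ≤ C) {k : ℕ}
    (hgr : ∀ x : (Fin m → ℂ) × ℂ, (P.map (MvPolynomial.eval x.1)).eval x.2 = 0 → ‖g x‖ ≤ C * (1 + ‖x‖) ^ k) :
    ∃ q : MvPolynomial (Fin (m + 1)) ℂ, q.totalDegree ≤ k ∧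
      ∀ (w : Fin m → ℂ) (t : ℂ), (P.map (MvPolynomial.eval w)).eval t = 0 →
        MvPolynomial.eval (Fin.cons t w : Fin (m + 1) → ℂ) q = g (w, t) := by
  classical
  obtain ⟨L, hL, hroot⟩ := exists_norm_root_le' P hc hPd hPlead hPcoef
  obtain ⟨S, hSeval, hSdeg, hΔdeg, hΔne, hΔnodup⟩ := exists_powerSums' P hc hPd hPlead hPcoef hsep
  set H : Matrix (Fin d) (Fin d) (MvPolynomial (Fin m) ℂ) := Matrix.of fun i j : Fin d ↦ S (i.1 + j.1) with hH
  have hne0 := map_eval_ne_zero P hc hPlead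
  -- fibre sums and interpolation coefficients
  choose b hbdeg hbeval using fun l ↦ exists_mvPolynomial_fibreSum P hc hPd hPlead hL hroot hhol hC hgr l
  choose a hadiff haeq using fun j ↦ exists_differentiable_eq_coeff_interpolate P hc hPd hPlead hL hroot hhol
    H.det hΔne (fun w hw ↦ (hΔnodup w).mp hw) j
  -- the Hankel system `Σ_j S_{l+j}(w) a_j(w) = b_l(w)`, off the discriminant and then everywhere
  have hsys : ∀ (l : ℕ) (w : Fin m → ℂ), ∑ j ∈ range d, MvPolynomial.eval w (S (l + j)) * a j w =
      MvPolynomial.eval w (b l) := by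
    intro l
    have hdense : Dense {w : Fin m → ℂ | MvPolynomial.eval w H.det ≠ 0} :=
      BranchedCoveringSCV.dense_setOf_eval_ne_zero hΔne
    have hclosed : IsClosed {w : Fin m → ℂ | ∑ j ∈ range d, MvPolynomial.eval w (S (l + j)) * a j w =
        MvPolynomial.eval w (b l)} := by
      refine isClosed_eq ?_ (BranchedCoveringSCV.differentiable_eval (b l)).continuous
      exact continuous_finsetSum _ fun j _ ↦
        (BranchedCoveringSCV.differentiable_eval _).continuous.mul (hadiff j).continuous
    have hsub : {w : Fin m → ℂ | MvPolynomial.eval w H.det ≠ 0} ⊆ {w | ∑ j ∈ range d,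
        MvPolynomial.eval w (S (l + j)) * a j w = MvPolynomial.eval w (b l)} := by
      intro w hw
      have hnd : (P.map (MvPolynomial.eval w)).roots.Nodup := (hΔnodup w).mp hw
      set R := (P.map (MvPolynomial.eval w)).roots.toFinset with hR
      have hRcard : R.card = d := by
        rw [hR, Multiset.toFinset_card_of_nodup hnd, card_roots_map_eval P hc hPd hPlead]
      show ∑ j ∈ range d, MvPolynomial.eval w (S (l + j)) * a j w = MvPolynomial.eval w (b l)
      have h1 := LagrangeContour.sum_powerSum_mul_coeff_interpolate R (fun r ↦ g (w, r)) l
      rw [hRcard] at h1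
      rw [hbeval, multiset_roots_map_sum_eq P hnd, ← h1]
      refine Finset.sum_congr rfl fun j _ ↦ ?_
      rw [hSeval, multiset_roots_map_sum_eq P hnd, haeq j w hw]
    intro w
    have : w ∈ {w : Fin m → ℂ | ∑ j ∈ range d, MvPolynomial.eval w (S (l + j)) * a j w =
        MvPolynomial.eval w (b l)} := by
      rw [← hclosed.closure_eq]
      exact (hdense.mono hsub).closure_eq ▸ mem_univ w
    exact this
  -- Cramer: `Δ(w) a_j(w) = (adj H · b)_j (w)`
  set Pj : Fin d → MvPolynomial (Fin m) ℂ := fun j ↦ ∑ l, H.adjugate j l * b l.1 with hPj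
  have hcramer : ∀ (j : Fin d) (w : Fin m → ℂ), MvPolynomial.eval w H.det * a j.1 w = MvPolynomial.eval w (Pj j) := by
    intro j w
    set Hw : Matrix (Fin d) (Fin d) ℂ := (MvPolynomial.eval w).mapMatrix H with hHw
    have hmul : Matrix.mulVec Hw (fun j : Fin d ↦ a j.1 w) = fun l : Fin d ↦ MvPolynomial.eval w (b l.1) := by
      funext l
      rw [Matrix.mulVec, dotProduct]
      simp only [hHw, RingHom.mapMatrix_apply, Matrix.map_apply, hH, Matrix.of_apply]
      rw [← hsys l.1 w, Finset.sum_fin_eq_sum_range]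
      refine Finset.sum_congr rfl fun j hj ↦ ?_
      rw [dif_pos (Finset.mem_range.mp hj)]
    have hadj := congrArg (fun v ↦ Matrix.mulVec (H.adjugate.map (MvPolynomial.eval w)) v) hmul
    beta_reduce at hadj
    rw [Matrix.mulVec_mulVec, show H.adjugate.map (MvPolynomial.eval w) = Hw.adjugate by
        rw [hHw, ← RingHom.mapMatrix_apply, RingHom.map_adjugate], Matrix.adjugate_mul, Matrix.smul_mulVec,
      Matrix.one_mulVec] at hadj
    have hj := congrFun hadj j
    simp only [Pi.smul_apply, smul_eq_mul] at hj
    rw [hHw, ← RingHom.map_det] at hj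
    have hmap : ∀ l, ((MvPolynomial.eval w).mapMatrix H).adjugate j l = MvPolynomial.eval w (H.adjugate j l) := by
      intro l
      have := congrFun (congrFun (RingHom.map_adjugate (MvPolynomial.eval w) H) j) l
      rw [RingHom.mapMatrix_apply, Matrix.map_apply] at this
      exact this.symm
    rw [hj, hPj]
    simp only [map_sum, map_mul, Matrix.mulVec, dotProduct, hmap]
  -- the `a_j` are polynomials `A_j` with `deg A_j + j ≤ k`
  have hHdeg : ∀ i j : Fin d, (H i j).totalDegree ≤ i.1 + j.1 := fun i j ↦ by
    simp only [hH, Matrix.of_apply]; exact hSdeg _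
  have hdpos : ∀ j : Fin d, j.1 ≤ d * (d - 1) + k := by
    intro j
    have hj := j.2
    have h1 : d - 1 ≤ d * (d - 1) := Nat.le_mul_of_pos_left (d - 1) (by omega)
    omega
  have hA : ∀ j : Fin d, ∃ A : MvPolynomial (Fin m) ℂ, (A ≠ 0 → A.totalDegree + j.1 ≤ k) ∧
      ∀ w, MvPolynomial.eval w A = a j.1 w := by
    intro j
    obtain ⟨A, hΔA, hAeval⟩ := exists_mvPolynomial_eval_eq_of_eval_mul_eq hΔne (hadiff j.1).continuous (hcramer j)
    refine ⟨A, fun hA0 ↦ ?_, hAeval⟩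
    have hdeg := totalDegree_add_eq_of_mul_eq hΔne hA0 hΔA
    have hterm : ∀ l : Fin d, (H.adjugate j l * b l.1).totalDegree + j.1 ≤ d * (d - 1) + k := by
      intro l
      have h1 := totalDegree_adjugate_add_le H hHdeg j l
      have h2 := hbdeg l.1
      have h3 := MvPolynomial.totalDegree_mul (H.adjugate j l) (b l.1)
      omega
    have hPjdeg : (Pj j).totalDegree + j.1 ≤ d * (d - 1) + k := by
      have hsup : (Pj j).totalDegree ≤ d * (d - 1) + k - j.1 := by
        refine (MvPolynomial.totalDegree_finsetSum _ _).trans (Finset.sup_le fun l _ ↦ ?_)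
        have := hterm l
        omega
      have := hdpos j
      omega
    rw [hΔdeg] at hdeg
    omega
  choose A hAdeg hAeval using hA
  -- the polynomial `q = Σ_j A_j t^j`
  refine ⟨∑ j : Fin d, MvPolynomial.rename Fin.succ (A j) * MvPolynomial.X 0 ^ j.1, ?_, ?_⟩
  · refine (MvPolynomial.totalDegree_finsetSum _ _).trans (Finset.sup_le fun j _ ↦ ?_)
    by_cases hA0 : A j = 0
    · simp [hA0]
    · refine (MvPolynomial.totalDegree_mul _ _).trans ?_
      refine (add_le_add (MvPolynomial.totalDegree_rename_le _ _) (MvPolynomial.totalDegree_pow _ _)).trans ?_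
      rw [MvPolynomial.totalDegree_X, mul_one]
      exact hAdeg j hA0
  · -- `q = g` on `U`
    have hevalq : ∀ (w : Fin m → ℂ) (t : ℂ), MvPolynomial.eval (Fin.cons t w : Fin (m + 1) → ℂ)
        (∑ j : Fin d, MvPolynomial.rename Fin.succ (A j) * MvPolynomial.X 0 ^ j.1) = ∑ j : Fin d, a j.1 w * t ^ j.1 := by
      intro w t
      rw [map_sum]
      refine Finset.sum_congr rfl fun j _ ↦ ?_
      rw [map_mul, map_pow, MvPolynomial.eval_X, Fin.cons_zero, MvPolynomial.eval_rename,
        show ((Fin.cons t w : Fin (m + 1) → ℂ) ∘ Fin.succ) = w from funext fun i ↦ by simp, hAeval]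
    -- on the generic fibres
    have hgen : ∀ (w : Fin m → ℂ) (t : ℂ), MvPolynomial.eval w H.det ≠ 0 → (P.map (MvPolynomial.eval w)).eval t = 0 →
        ∑ j : Fin d, a j.1 w * t ^ j.1 = g (w, t) := by
      intro w t hw ht
      have hnd : (P.map (MvPolynomial.eval w)).roots.Nodup := (hΔnodup w).mp hw
      set R := (P.map (MvPolynomial.eval w)).roots.toFinset with hR
      have hRcard : R.card = d := by
        rw [hR, Multiset.toFinset_card_of_nodup hnd, card_roots_map_eval P hc hPd hPlead]
      have htR : t ∈ R := Multiset.mem_toFinset.mpr ((mem_roots (hne0 w)).mpr ht)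
      have h1 := LagrangeContour.sum_coeff_interpolate_mul_pow R htR (fun r ↦ g (w, r))
      rw [hRcard, Finset.sum_range (fun j ↦ (interpolate R id fun r ↦ g (w, r)).coeff j * t ^ j)] at h1
      rw [← h1]
      exact Finset.sum_congr rfl fun j _ ↦ by rw [haeq j.1 w hw]
    -- everywhere on `U`, by continuity
    intro w₀ t₀ h0
    rw [hevalq]
    set φ : (Fin m → ℂ) × ℂ → ℂ := fun x ↦ ∑ j : Fin d, a j.1 x.1 * x.2 ^ j.1 - g x with hφ
    have hφcont : ContinuousWithinAt φ {y | (P.map (MvPolynomial.eval y.1)).eval y.2 = 0} (w₀, t₀) := by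
      refine ContinuousWithinAt.sub (Continuous.continuousWithinAt ?_) (continuousWithinAt_of_hhol P hhol h0)
      exact continuous_finsetSum _ fun j _ ↦
        (((hadiff j.1).continuous).comp continuous_fst).mul (continuous_snd.pow _)
    by_contra hne
    have hφ0 : φ (w₀, t₀) ≠ 0 := fun h ↦ hne (sub_eq_zero.mp h)
    have hεpos : 0 < ‖φ (w₀, t₀)‖ / 2 := by positivity
    obtain ⟨η, hη, hηφ⟩ := Metric.continuousWithinAt_iff.mp hφcont _ hεpos
    obtain ⟨w, t, hwΔ, hwt, hdw, hdt⟩ := exists_generic_point_near P hc hPd hPlead hL hroot H.det hΔne h0 hη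
    have hzero : φ (w, t) = 0 := sub_eq_zero.mpr (hgen w t hwΔ hwt)
    have hdist : dist ((w, t) : (Fin m → ℂ) × ℂ) (w₀, t₀) < η := by
      rw [Prod.dist_eq]; exact max_lt hdw hdt
    have := hηφ hwt hdist
    rw [hzero, dist_zero_left] at this
    linarith

end AffineHypersurface

end Literature.Analysis.Complex
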